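import Literature.Probability.RandomPlanarGeometry.HexSAWRotSurfaceYcGrowth
import Literature.Probability.RandomPlanarGeometry.HexSAWBrickWallBridges
import HarnessLib

/-!
# Beaton's rotated-frame surface fugacity: the LIMIT `μ(y) = lim_n C⁺_n(y)^{1/n} = μ` for `0 < y ≤ y†`, and `μ_Bridge(ℍ) = μ_ℍ`
# (door (c-rot-lim) «HEX-YC-ROT-LIMIT-SUB» of the lane «pcv-sawmu»; continues R4 `HexSAWRotSurfaceYcGrowth.lean`; frame twin of T5 `HexSAWSurfaceYcLimit.lean`)

Topic `Literature/Probability/RandomPlanarGeometry` (continues `HexSAWRotSurfaceYcGrowth.lean` — R4: `rotHpWalks`, `rotHpCoeff n y = C⁺_n(y)`,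
`RotGrowthLe`, `RotGrowthGt`, `RotGrowthGe`, `rotGrowthLe_iff_le : RotGrowthLe y ↔ y ≤ y†`, `mul_rotHpCoeff_one_le`,
`bridgeCount_le_sum_card_brSpan`, `exists_getLast?_of_mem_image_revTop` —, `HexSAWRotSurfaceYcFaces.lean` — R1: `rotTopLists`, `revTop`,
`revTop_mem`, `revTop_injOn`, `rotHpLists` —, `HexSAWRotStripDictionary.lean` — `HV.rho`, `HV.rotWalk`, `HV.rotWalk_mem`, `HexBW.card_brSpan_eq` —
and the brick-wall bridge files `HexSAWBrickWallBridges.lean` (`HexBW.bridgeCount_mul_le`, `bridgeCount_le_pow`, `one_le_bridgeCount`) /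
`HexSAWBrickWallBridgeDivergence.lean` (`HexBW.not_summable_bridgeCount_div_pow`)).

Sources. N. R. Beaton, *The critical surface fugacity of self-avoiding walks on a rotated honeycomb lattice*, J. Phys. A 47
(2014) 075003 (arXiv:1210.0274), §3.1 (arXiv v3 p. 11: "`c^+_n(m)` is the number of `n`-step SAWs starting on the boundary of the
half-space and occupying `m` vertices in the surface"; Proposition 7, p. 11: "`μ(y) := lim C_n^+(y)^{1/n}` exists … For `0 < y ≤ 1`,
`μ(y) = μ(1) = μ` … `μ(y) = μ` if `y ≤ y_c`, `> μ` if `y > y_c`"), §3.2 (p. 15: "By the symmetry of bridges").  N. Madras, G. Slade,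
*The Self-Avoiding Walk*, Birkhäuser 1993, §1.2 (p. 11: (1.2.15) `b_{m+n} ≥ b_m b_n`, (1.2.16) "{-log b_n} is subadditive",
(1.2.17) `μ_Bridge = lim b_n^{1/n} = sup_n b_n^{1/n} ≤ μ`, "Clearly `b_n ≤ c_n`"; Lemma 1.2.2 (Fekete) is printed on p. 9), §3.1 (p. 61:
Corollary 3.1.6, (3.1.10) "`μ_Bridge = μ`"; Corollary 3.1.8, (3.1.11) "`B(z_c) = Σ_N b_N μ^{-N} = +∞`").  H. Duminil-Copin, S. Smirnov, Ann. of Math. 175 (2012) 1653, Theorem 1 (`μ = √(2+√2)`),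
§3 (bridges of the hexagonal lattice).  J. M. Hammersley, G. M. Torrie, S. G. Whittington, J. Phys. A 15 (1982) 539 (existence of `μ(y)`
for all `y`, invoked by Beaton; NOT formalised and NOT used).

## What is proved (lane «pub-sawmu», door (c-rot-lim); design a-idea-1 gen 20, lens: bridge decompositions with explicit rates)

R4 records Beaton's Proposition 7 in limsup/RATE form (`RotGrowthLe y ↔ y ≤ y†`, and the `≥ μ` half `RotGrowthGe y` FREQUENTLY) and leaves
"only the existence of the limit `lim C⁺_n(y)^{1/n}` (HTW82)" undecided.  This file decides that existence on the whole desorbed regime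
`0 < y ≤ y†`, endpoint included, with tree-only inputs and no unfolding — the frame twin of T5 — and records `μ_Bridge(ℍ) = μ_ℍ` on the way:
* BRICK-WALL BRIDGES, RATE FORM (`namespace HexBW`): `bridgeU n := b_n(ℍ) μ^{-n}` is supermultiplicative (tree `bridgeCount_mul_le`,
  Madras–Slade (1.2.15)), `≤ 1` (tree `bridgeCount_le_pow`) and NOT summable (tree `not_summable_bridgeCount_div_pow`, Madras–Slade (3.1.11));
  Fekete's lemma (Mathlib `Subadditive.tendsto_lim`) on `-log bridgeU` gives `tendsto_log_bridgeU_div : log(b_n μ^{-n})/n → 0`, whence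
  `eventually_pow_le_bridgeCount : 0 < τ < μ → ∀ᶠ n, τⁿ ≤ b_n(ℍ)` and **`tendsto_bridgeCount_rpow : b_n(ℍ)^{1/n} → μ_ℍ`** (Madras–Slade
  Corollary 3.1.6 (3.1.10) for the brick-wall hexagonal lattice, with `μ_ℍ = √(2+√2)` from Duminil-Copin–Smirnov);
* THE TERMWISE DICTIONARY (`namespace HV`): `rotBridgeImage A ω := revTop A (ω.map rho)` carries a list-model bridge of `ℍ` of length `n` and
  span `A` (tree `HV.bridgeFin`, `HV.htAt`) to a rotated half-plane walk with `n + 1` vertices (tree `HV.rotWalk_mem` — Beaton's Appendix map: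
  rotate by `ρ`, exit through the top of `D(A, n+1)` — then R1's reversal–reflection `revTop A`, §3.2 "By the symmetry of bridges"),
  injectively, different spans ending at different depths `ξ = −A`: **`bridgeCount_le_rotHpCoeff_one_succ : 1 ≤ n → b_n(ℍ) ≤ C⁺_{n+1}(1)`**
  (Madras–Slade's "Clearly `b_n ≤ c_n`" in Beaton's half-plane);
* RATE FORMS: `RotGrowthGeRate y ρ := ∀ 0 ≤ r < ρ, ∀ᶠ n, rⁿ ≤ C⁺_n(y)` ("`liminf C⁺_n(y)^{1/n} ≥ ρ`", EVENTUAL — it implies R4's frequently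
  form `RotGrowthGe`), `eventually_mul_pow_le_rotHpCoeff_one`, **`rotGrowthGeRate_mu_of_pos : 0 < y → RotGrowthGeRate y μ`** (`y ≥ 1` by
  monotonicity, `0 < y < 1` through R4's lift `y · C⁺_n(1) ≤ C⁺_{n+2}(y)`);
* THE LIMIT: the squeeze `tendsto_rotHpCoeff_rpow_of_rates` and **`tendsto_rotHpCoeff_rpow_of_le (hy0 : 0 < y) (hy : y ≤ rotYdagger) :
  Tendsto (fun n => rotHpCoeff n y ^ (1/n)) atTop (𝓝 hexConnectiveConstant)`** — Beaton's "`μ(y) = μ` if `y ≤ y_c`" with `μ(y)` an honest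
  limit —, the dichotomy **`tendsto_rotHpCoeff_rpow_iff (hy0 : 0 < y) : (C⁺_n(y)^{1/n} → μ) ↔ y ≤ rotYdagger`** (above `y†` a rate `r > μ`
  recurs, R4's `rotGrowthGt_iff`) and `tendsto_rotHpCoeff_rpow_iff_le_hexRotSurfaceYc` (against R3's sup-radius `hexRotSurfaceYc = y†`).
Not decided here: the existence of `lim C⁺_n(y)^{1/n}` for `y > y†` (Hammersley–Torrie–Whittington 1982) and Beaton's `√y` half of
"`μ(y) ≥ max{μ, √y}`" in this frame (a surface zig-zag; the DCS-frame twin is T5's `growthGeRate_sqrt`).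

LABEL: CONSOLIDATION (Beaton 2014 Prop. 7 "`μ(y) = μ` if `y ≤ y_c`" with the limit made honest on `y ≤ y_c`; `μ_Bridge(ℍ) = μ_ℍ` =
Madras–Slade (1.2.17)/(3.1.10) in the brick-wall frame) — Fekete / supermultiplicativity / the span decomposition are textbook
(Madras–Slade §1.2, §3.1); the reversal is Beaton §3.2.
-/

noncomputable section

open Finset Filter Topology

namespace Literature.Probability.RandomPlanarGeometry.SAW

namespace HexBW

/-! ### Brick-wall bridges: `u_n := b_n(ℍ) μ_ℍ^{-n}` is supermultiplicative, `≤ 1`, not summable ⇒ `b_n^{1/n} → μ` -/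

/-- **`u_n := b_n(ℍ) μ_ℍ^{-n}`**, the renewal sequence of the brick-wall bridges at criticality.
[cite: MadrasSlade1993, §1.2, (1.2.15)–(1.2.17) (p. 11); MadrasSlade1993, Corollary 3.1.8, (3.1.11) (p. 61)] -/
def bridgeU (n : ℕ) : ℝ := (bridgeCount n : ℝ) / hexConnectiveConstant ^ n

/-- `u_0 = 1`. [cite: MadrasSlade1993, §1.2 (p. 11: "b_0 = 1")] -/
theorem bridgeU_zero : bridgeU 0 = 1 := by simp [bridgeU, bridgeCount_zero]

/-- `u_n > 0` (`b_n ≥ 1`, tree `one_le_bridgeCount`). [cite: MadrasSlade1993, §1.2, (1.2.15) (p. 11)] -/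
theorem bridgeU_pos (n : ℕ) : 0 < bridgeU n := by
  have h1 : (1 : ℝ) ≤ bridgeCount n := by exact_mod_cast one_le_bridgeCount n
  exact div_pos (by linarith) (pow_pos hexConnectiveConstant_pos n)

/-- `u_n ≤ 1` (`b_n ≤ μⁿ`, tree `bridgeCount_le_pow`). [cite: MadrasSlade1993, §1.2, (1.2.17) (p. 11: "μ_Bridge ≤ μ", "b_n ≤ μ_Bridge^n")] -/
theorem bridgeU_le_one (n : ℕ) : bridgeU n ≤ 1 :=
  (div_le_one (pow_pos hexConnectiveConstant_pos n)).2 (bridgeCount_le_pow n)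

/-- **Supermultiplicativity `u_m u_n ≤ u_{m+n}`** (concatenation of bridges, tree `bridgeCount_mul_le`). [cite: MadrasSlade1993, §1.2, (1.2.15) (p. 11: "b_{m+n} ≥ b_m b_n")] -/
theorem bridgeU_mul_le (m n : ℕ) : bridgeU m * bridgeU n ≤ bridgeU (m + n) := by
  have h : ((bridgeCount m : ℝ)) * bridgeCount n ≤ bridgeCount (m + n) := by exact_mod_cast bridgeCount_mul_le m n
  rw [bridgeU, bridgeU, bridgeU, div_mul_div_comm, ← pow_add]
  exact div_le_div_of_nonneg_right h (pow_nonneg hexConnectiveConstant_pos.le _)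

/-- `n ↦ -log u_n` is subadditive. [cite: MadrasSlade1993, §1.2, (1.2.16) (p. 11: "{-log b_n} is subadditive")] -/
theorem subadditive_neg_log_bridgeU : Subadditive fun n : ℕ => -Real.log (bridgeU n) := by
  intro m n
  have h := Real.log_le_log (mul_pos (bridgeU_pos m) (bridgeU_pos n)) (bridgeU_mul_le m n)
  rw [Real.log_mul (bridgeU_pos m).ne' (bridgeU_pos n).ne'] at h
  dsimp only
  linarith

/-- `Σ_n u_n = +∞` (tree `not_summable_bridgeCount_div_pow`, Madras–Slade (3.1.14) at `z = 1/μ`). [cite: MadrasSlade1993, Corollary 3.1.8, (3.1.11) (p. 61: "Σ_N b_N μ^{-N} = +∞")] -/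
theorem not_summable_bridgeU : ¬ Summable bridgeU := not_summable_bridgeCount_div_pow

/-- **`log u_n / n → 0`**: Fekete's lemma gives `-log u_n / n → L = inf ≥ 0`, and `L > 0` would make `u_n ≤ e^{-Ln}` summable, against
`Σ_n u_n = +∞`. [cite: MadrasSlade1993, §1.2, Lemma 1.2.2 (p. 9) and (1.2.16)–(1.2.17) (p. 11); MadrasSlade1993, Corollary 3.1.8, (3.1.11) (p. 61)] -/
theorem tendsto_log_bridgeU_div : Tendsto (fun n : ℕ => Real.log (bridgeU n) / n) atTop (𝓝 0) := by
  have ha := subadditive_neg_log_bridgeU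
  have ha0 : ∀ n : ℕ, 0 ≤ -Real.log (bridgeU n) := fun n =>
    neg_nonneg.2 (Real.log_nonpos (bridgeU_pos n).le (bridgeU_le_one n))
  have hbdd : BddBelow (Set.range fun n : ℕ => -Real.log (bridgeU n) / n) :=
    ⟨0, by rintro _ ⟨n, rfl⟩; exact div_nonneg (ha0 n) (Nat.cast_nonneg n)⟩
  have hlim := ha.tendsto_lim hbdd
  have hL0 : 0 ≤ ha.lim :=
    ge_of_tendsto' hlim fun n => div_nonneg (ha0 n) (Nat.cast_nonneg n)
  have hL : ha.lim = 0 := by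
    by_contra hne
    have hLpos : 0 < ha.lim := lt_of_le_of_ne hL0 (Ne.symm hne)
    have hq1 : Real.exp (-ha.lim) < 1 := Real.exp_lt_one_iff.2 (by linarith)
    refine not_summable_bridgeU (Summable.of_nonneg_of_le (fun n => (bridgeU_pos n).le) (fun n => ?_)
      (summable_geometric_of_lt_one (Real.exp_pos _).le hq1))
    rcases Nat.eq_zero_or_pos n with rfl | hn
    · rw [bridgeU_zero, pow_zero]
    · have h1 : ha.lim ≤ -Real.log (bridgeU n) / n := ha.lim_le_div hbdd hn.ne'
      have hn' : (0 : ℝ) < n := by exact_mod_cast hn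
      rw [le_div_iff₀ hn'] at h1
      calc bridgeU n = Real.exp (Real.log (bridgeU n)) := (Real.exp_log (bridgeU_pos n)).symm
        _ ≤ Real.exp (n * -ha.lim) := Real.exp_le_exp.2 (by linarith)
        _ = Real.exp (-ha.lim) ^ n := Real.exp_nat_mul _ _
  rw [hL] at hlim
  have h := hlim.neg
  rw [neg_zero] at h
  refine h.congr fun n => ?_
  rw [neg_div, neg_neg]

/-- Eventually `(τ/μ)ⁿ ≤ u_n` for every rate `0 < τ < μ`. [cite: MadrasSlade1993, §1.2, (1.2.16)–(1.2.17) (p. 11)] -/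
theorem eventually_pow_le_bridgeU {τ : ℝ} (hτ0 : 0 < τ) (hτ : τ < hexConnectiveConstant) :
    ∀ᶠ n : ℕ in atTop, (τ / hexConnectiveConstant) ^ n ≤ bridgeU n := by
  have hμ : 0 < hexConnectiveConstant := hτ0.trans hτ
  set q := τ / hexConnectiveConstant with hq
  have hq0 : 0 < q := div_pos hτ0 hμ
  have hq1 : q < 1 := (div_lt_one hμ).2 hτ
  have hlog : Real.log q < 0 := Real.log_neg hq0 hq1
  have hev := (tendsto_order.1 tendsto_log_bridgeU_div).1 _ hlog
  filter_upwards [hev, eventually_gt_atTop 0] with n hn hn0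
  have hn' : (0 : ℝ) < n := by exact_mod_cast hn0
  rw [lt_div_iff₀ hn'] at hn
  rw [← Real.log_le_log_iff (pow_pos hq0 _) (bridgeU_pos n), Real.log_pow]
  nlinarith

/-- **`b_n(ℍ)^{1/n} → μ`, rate form**: for every `0 < τ < μ`, eventually `τⁿ ≤ b_n(ℍ)`.
[cite: MadrasSlade1993, Corollary 3.1.6, (3.1.10) (p. 61: "μ_Bridge = μ"); DuminilCopinSmirnov2012, §3] -/
theorem eventually_pow_le_bridgeCount {τ : ℝ} (hτ0 : 0 < τ) (hτ : τ < hexConnectiveConstant) :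
    ∀ᶠ n : ℕ in atTop, τ ^ n ≤ (bridgeCount n : ℝ) := by
  have hμ : 0 < hexConnectiveConstant := hτ0.trans hτ
  filter_upwards [eventually_pow_le_bridgeU hτ0 hτ] with n hn
  have h : bridgeU n * hexConnectiveConstant ^ n = bridgeCount n := by
    rw [bridgeU, div_mul_cancel₀ _ (pow_ne_zero _ hμ.ne')]
  calc τ ^ n = (τ / hexConnectiveConstant) ^ n * hexConnectiveConstant ^ n := by
        rw [div_pow, div_mul_cancel₀ _ (pow_ne_zero _ hμ.ne')]
    _ ≤ bridgeU n * hexConnectiveConstant ^ n := mul_le_mul_of_nonneg_right hn (pow_nonneg hμ.le _)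
    _ = bridgeCount n := h

/-- **`μ_Bridge(ℍ) = μ_ℍ`: `b_n(ℍ)^{1/n} → μ = √(2+√2)`** (squeeze between the eventual lower rates and `b_n ≤ μⁿ`).
[cite: MadrasSlade1993, Corollary 3.1.6, (3.1.10) (p. 61: "μ_Bridge = μ") with §1.2, (1.2.17) (p. 11); DuminilCopinSmirnov2012, Theorem 1 (μ = √(2+√2)), §3] -/
theorem tendsto_bridgeCount_rpow :
    Tendsto (fun n : ℕ => (bridgeCount n : ℝ) ^ ((n : ℝ)⁻¹)) atTop (𝓝 hexConnectiveConstant) := by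
  have hμ := hexConnectiveConstant_pos
  rw [tendsto_order]
  constructor
  · intro a ha
    set r := (max a 0 + hexConnectiveConstant) / 2 with hr_def
    have hmax : max a 0 < hexConnectiveConstant := max_lt ha hμ
    have hr0 : 0 < r := by rw [hr_def]; have := le_max_right a 0; linarith
    have har : a < r := by rw [hr_def]; have := le_max_left a 0; linarith
    have hrμ : r < hexConnectiveConstant := by rw [hr_def]; linarith
    filter_upwards [eventually_pow_le_bridgeCount hr0 hrμ, eventually_ne_atTop 0] with n hn hn0
    calc a < r := har
      _ = (r ^ n) ^ ((n : ℝ)⁻¹) := (Real.pow_rpow_inv_natCast hr0.le hn0).symm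
      _ ≤ (bridgeCount n : ℝ) ^ ((n : ℝ)⁻¹) := Real.rpow_le_rpow (pow_nonneg hr0.le n) hn (inv_nonneg.2 (Nat.cast_nonneg n))
  · intro b hb
    filter_upwards [eventually_ne_atTop 0] with n hn0
    calc (bridgeCount n : ℝ) ^ ((n : ℝ)⁻¹) ≤ (hexConnectiveConstant ^ n) ^ ((n : ℝ)⁻¹) :=
          Real.rpow_le_rpow (Nat.cast_nonneg _) (bridgeCount_le_pow n) (inv_nonneg.2 (Nat.cast_nonneg n))
      _ = hexConnectiveConstant := Real.pow_rpow_inv_natCast hμ.le hn0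
      _ < b := hb

end HexBW

namespace HV

/-! ### The termwise dictionary: a bridge of `ℍ` of length `n` is a rotated half-plane walk with `n + 1` vertices -/

section Dictionary

variable {n A N : ℕ} {ω : List HV}

/-- The list-model bridges of `ℍ` of length `n` and span `A`. [cite: MadrasSlade1993, Definition 1.2.4 (span of a bridge)] -/
def bridgeFinSpan (n A : ℕ) : Finset (List HV) := (bridgeFin n).filter fun ω => htAt ω n = (A : ℤ)

/-- `#bridgeFinSpan n A = b_{n,A}(ℍ)` (tree `HexBW.card_brSpan_eq`). [cite: MadrasSlade1993, Definition 1.2.4] -/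
theorem card_bridgeFinSpan (n A : ℕ) : #(bridgeFinSpan n A) = #(HexBW.brSpan n (A : ℤ)) :=
  (HexBW.card_brSpan_eq n (A : ℤ)).symm

/-- **The image of a bridge in Beaton's half-plane**: rotate by `ρ` (the inner list of the tree's `rotWalk`), then apply R1's
reversal–reflection `revTop A` of depth `A`. [cite: Beaton2014RotatedHoneycomb, Appendix (PP-bridges) and §3.2 ("By the symmetry of bridges", arXiv v3 p. 15)] -/
def rotBridgeImage (A : ℕ) (ω : List HV) : List HV := revTop A (ω.map rho)

/-- The rotated bridge is a top list of `D(A, N)` for `n < N`. [cite: Beaton2014RotatedHoneycomb, Appendix (PP-bridges; arXiv v3 p. 20), §2.2 (D_{T,L})] -/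
theorem map_rho_mem_rotTopLists (hA : 1 ≤ A) (hω : ω ∈ bridgeFinSpan n A) (hnN : n < N) : ω.map rho ∈ rotTopLists A N := by
  obtain ⟨hω1, hω2⟩ := mem_filter.1 hω
  rw [rotTopLists, mem_image]
  exact ⟨rotWalk ω, rotWalk_mem hA hω1 hω2 hnN, by rw [rotWalk, inner_cons_append]⟩

/-- A list-model bridge of length `n` has `n + 1` vertices. [cite: MadrasSlade1993, Definition 1.2.4] -/
theorem length_of_mem_bridgeFinSpan (hω : ω ∈ bridgeFinSpan n A) : ω.length = n + 1 := by
  obtain ⟨hω1, -⟩ := mem_filter.1 hω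
  exact (mem_sawLists_iff.1 (mem_sawFin_iff.1 (bridgeFin_subset n hω1))).2.2.1

/-- **The image is a rotated half-plane walk with `n + 1` vertices.** [cite: Beaton2014RotatedHoneycomb, §3.2 ("By the symmetry of bridges", arXiv v3 p. 15), §3.1 (c^+_n(m), p. 11)] -/
theorem rotBridgeImage_mem_rotHpWalks (hA : 1 ≤ A) (hω : ω ∈ bridgeFinSpan n A) : rotBridgeImage A ω ∈ rotHpWalks (n + 1) := by
  have hl := map_rho_mem_rotTopLists hA hω (Nat.lt_succ_self n)
  refine rotHpFibre_subset A (3 * A + 3 * (n + 1) + 9) (n + 1) (mem_filter.2 ⟨revTop_mem hA hl, ?_⟩)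
  rw [rotBridgeImage, length_revTop, List.length_map, length_of_mem_bridgeFinSpan hω]

/-- The image lies in R1's reversed top lists of depth `A` (for the depth bookkeeping). [cite: Beaton2014RotatedHoneycomb, §3.2 (arXiv v3 p. 15)] -/
theorem rotBridgeImage_mem_image_revTop (hA : 1 ≤ A) (hω : ω ∈ bridgeFinSpan n A) :
    rotBridgeImage A ω ∈ (rotTopLists A (n + 1)).image (revTop A) :=
  mem_image_of_mem _ (map_rho_mem_rotTopLists hA hω (Nat.lt_succ_self n))

/-- `rotBridgeImage A` is injective on the bridges of span `A` (R1's `revTop_injOn`, `ρ` injective). [cite: Beaton2014RotatedHoneycomb, §3.2 (arXiv v3 p. 15), Appendix (PP-bridges)] -/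
theorem rotBridgeImage_injOn (hA : 1 ≤ A) : Set.InjOn (rotBridgeImage A) (bridgeFinSpan n A : Set (List HV)) := by
  intro ω hω ω' hω' h
  have h1 : ω.map rho = ω'.map rho :=
    revTop_injOn hA (map_rho_mem_rotTopLists hA (mem_coe.1 hω) (Nat.lt_succ_self n))
      (map_rho_mem_rotTopLists hA (mem_coe.1 hω') (Nat.lt_succ_self n)) h
  exact (List.map_injective_iff.2 rho_injective) h1

/-- Images of different spans are disjoint (they end at depth `ξ = −A`). [cite: Beaton2014RotatedHoneycomb, §3.2 ("By the symmetry of bridges", arXiv v3 p. 15)] -/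
theorem disjoint_image_rotBridgeImage {A A' : ℕ} (hA : 1 ≤ A) (hA' : 1 ≤ A') (hne : A ≠ A') :
    Disjoint ((bridgeFinSpan n A).image (rotBridgeImage A)) ((bridgeFinSpan n A').image (rotBridgeImage A')) := by
  rw [Finset.disjoint_left]
  intro g hg hg'
  obtain ⟨ω, hω, rfl⟩ := mem_image.1 hg
  obtain ⟨ω', hω', hgg⟩ := mem_image.1 hg'
  obtain ⟨v, hv, hxv⟩ := exists_getLast?_of_mem_image_revTop hA (rotBridgeImage_mem_image_revTop hA hω)
  obtain ⟨v', hv', hxv'⟩ := exists_getLast?_of_mem_image_revTop hA' (rotBridgeImage_mem_image_revTop hA' hω')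
  rw [hgg, hv] at hv'
  have hvv : v = v' := Option.some_injective _ hv'
  subst hvv
  omega

/-- `C⁺_n(1) = #rotHpWalks n`. [cite: Beaton2014RotatedHoneycomb, §3.1 (arXiv v3 p. 11: C_n^+(1) = c_n^+)] -/
theorem rotHpCoeff_one_eq_card (n : ℕ) : rotHpCoeff n 1 = #(rotHpWalks n) := by
  rw [rotHpCoeff]; simp

/-- **`b_n(ℍ) ≤ C⁺_{n+1}(1)` for `n ≥ 1`**: the span decomposition `b_n = Σ_{A=1}^{n} b_{n,A}` (R4's `bridgeCount_le_sum_card_brSpan`) and the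
injections `rotBridgeImage A` with pairwise disjoint images inside `rotHpWalks (n+1)`.
[cite: MadrasSlade1993, §1.2 (p. 11: "Clearly b_n ≤ c_n"), Definition 1.2.4; Beaton2014RotatedHoneycomb, §3.2 (arXiv v3 p. 15), Appendix (PP-bridges, p. 20)] -/
theorem bridgeCount_le_rotHpCoeff_one_succ {n : ℕ} (hn : 1 ≤ n) : (HexBW.bridgeCount n : ℝ) ≤ rotHpCoeff (n + 1) 1 := by
  classical
  have hA1 : ∀ a : ℕ, 1 ≤ a + 1 := fun a => Nat.succ_pos a
  set T : Finset (List HV) := (range n).biUnion fun a => (bridgeFinSpan n (a + 1)).image (rotBridgeImage (a + 1)) with hT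
  have hdisj : ((range n : Finset ℕ) : Set ℕ).PairwiseDisjoint
      (fun a => (bridgeFinSpan n (a + 1)).image (rotBridgeImage (a + 1))) := by
    intro a _ a' _ hne
    exact disjoint_image_rotBridgeImage (hA1 a) (hA1 a') (by omega)
  have hcardT : #T = ∑ a ∈ range n, #(bridgeFinSpan n (a + 1)) := by
    rw [hT, card_biUnion hdisj]
    exact sum_congr rfl fun a _ => card_image_of_injOn (rotBridgeImage_injOn (hA1 a))
  have hTsub : T ⊆ rotHpWalks (n + 1) := by
    intro g hg
    rw [hT, mem_biUnion] at hg
    obtain ⟨a, -, hg⟩ := hg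
    obtain ⟨ω, hω, rfl⟩ := mem_image.1 hg
    exact rotBridgeImage_mem_rotHpWalks (hA1 a) hω
  calc (HexBW.bridgeCount n : ℝ) ≤ ∑ a ∈ range n, (#(HexBW.brSpan n (a + 1 : ℕ)) : ℝ) :=
        bridgeCount_le_sum_card_brSpan hn le_rfl
    _ = ((∑ a ∈ range n, #(bridgeFinSpan n (a + 1)) : ℕ) : ℝ) := by
        rw [Nat.cast_sum]; exact sum_congr rfl fun a _ => by rw [card_bridgeFinSpan]
    _ = #T := by rw [hcardT]
    _ ≤ #(rotHpWalks (n + 1)) := by exact_mod_cast card_le_card hTsub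
    _ = rotHpCoeff (n + 1) 1 := (rotHpCoeff_one_eq_card _).symm

end Dictionary

/-! ### The rate form of `liminf C⁺_n(y)^{1/n} ≥ ρ` -/

/-- **"`liminf_n C⁺_n(y)^{1/n} ≥ ρ`"**, junk-free and EVENTUAL: every rate below `ρ` is eventually dominated by `C⁺_n(y)`.
(At `ρ = μ` it implies R4's frequently-form `RotGrowthGe y`.) [cite: Beaton2014RotatedHoneycomb, Proposition 7 (arXiv v3 p. 11: "μ(y) ≥ max{μ, √y}")] -/
def RotGrowthGeRate (y ρ : ℝ) : Prop :=
  ∀ r : ℝ, 0 ≤ r → r < ρ → ∀ᶠ n : ℕ in atTop, r ^ n ≤ rotHpCoeff n y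

/-- The eventual rate form at `μ` implies R4's frequently form. [cite: Beaton2014RotatedHoneycomb, Proposition 7 (arXiv v3 p. 11)] -/
theorem RotGrowthGeRate.rotGrowthGe {y : ℝ} (h : RotGrowthGeRate y hexConnectiveConstant) : RotGrowthGe y :=
  fun r hr0 hr => (h r hr0 hr).frequently

/-- Monotonicity of the rate form in `ρ`. [cite: Beaton2014RotatedHoneycomb, Proposition 7 (arXiv v3 p. 11)] -/
theorem RotGrowthGeRate.mono {y ρ ρ' : ℝ} (h : RotGrowthGeRate y ρ) (hρ : ρ' ≤ ρ) : RotGrowthGeRate y ρ' :=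
  fun r hr0 hr => h r hr0 (hr.trans_le hρ)

/-- **Eventual lower rate at `y = 1`, with a constant**: for `0 ≤ r < μ` and any constant `c`, eventually `c rⁿ ≤ C⁺_n(1)` (through
`b_{n-1}(ℍ) ≤ C⁺_n(1)` and the bridge rates). [cite: MadrasSlade1993, §1.2, (1.2.15)–(1.2.17) (p. 11) and Corollary 3.1.6 (3.1.10), Corollary 3.1.8 (3.1.11) (p. 61); Beaton2014RotatedHoneycomb, Proposition 7 (arXiv v3 p. 11: "For 0 < y ≤ 1, μ(y) = μ(1) = μ")] -/
theorem eventually_mul_pow_le_rotHpCoeff_one (c : ℝ) {r : ℝ} (hr0 : 0 ≤ r) (hr : r < hexConnectiveConstant) :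
    ∀ᶠ n : ℕ in atTop, c * r ^ n ≤ rotHpCoeff n 1 := by
  rcases hr0.eq_or_lt with rfl | hr0'
  · filter_upwards [eventually_ge_atTop 1] with n hn
    rw [zero_pow (by omega), mul_zero]
    exact rotHpCoeff_nonneg n zero_le_one
  · set τ := (r + hexConnectiveConstant) / 2 with hτ
    have hτr : r < τ := by rw [hτ]; linarith
    have hτμ : τ < hexConnectiveConstant := by rw [hτ]; linarith
    have hτ0 : 0 < τ := hr0'.trans hτr
    have h1 := HexBW.eventually_pow_le_bridgeCount hτ0 hτμ
    have hρ : 1 < τ / r := (one_lt_div hr0').2 hτr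
    have h2 : ∀ᶠ m : ℕ in atTop, c * r ^ (m + 1) ≤ τ ^ m := by
      have ht := (tendsto_pow_atTop_atTop_of_one_lt hρ).eventually_ge_atTop (c * r)
      filter_upwards [ht] with m hm
      have hrm : 0 < r ^ m := pow_pos hr0' _
      calc c * r ^ (m + 1) = c * r * r ^ m := by ring
        _ ≤ (τ / r) ^ m * r ^ m := mul_le_mul_of_nonneg_right hm hrm.le
        _ = τ ^ m := by rw [div_pow, div_mul_cancel₀ _ hrm.ne']
    obtain ⟨M, hM⟩ := eventually_atTop.1 (h1.and h2)
    refine eventually_atTop.2 ⟨M + 2, fun n hn => ?_⟩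
    obtain ⟨m, rfl⟩ : ∃ m, n = m + 1 := ⟨n - 1, by omega⟩
    obtain ⟨hb, hc⟩ := hM m (by omega)
    exact hc.trans (hb.trans (bridgeCount_le_rotHpCoeff_one_succ (by omega)))

/-- **`liminf_n C⁺_n(y)^{1/n} ≥ μ` for every `y > 0`** (rate form): for `y ≥ 1` by `C⁺_n(y) ≥ C⁺_n(1)`, for `0 < y < 1` through R4's lift
`y · C⁺_n(1) ≤ C⁺_{n+2}(y)`. [cite: Beaton2014RotatedHoneycomb, Proposition 7 (arXiv v3 p. 11: "μ(y) ≥ max{μ, √y}" — the `μ` half; "For 0 < y ≤ 1, μ(y) = μ(1) = μ")] -/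
theorem rotGrowthGeRate_mu_of_pos {y : ℝ} (hy : 0 < y) : RotGrowthGeRate y hexConnectiveConstant := by
  intro r hr0 hr
  rcases le_or_gt 1 y with hy1 | hy1
  · filter_upwards [eventually_mul_pow_le_rotHpCoeff_one 1 hr0 hr] with n hn
    rw [one_mul] at hn
    exact hn.trans (rotHpCoeff_mono n zero_le_one hy1)
  · obtain ⟨N, hN⟩ := eventually_atTop.1 (eventually_mul_pow_le_rotHpCoeff_one (r ^ 2 / y) hr0 hr)
    refine eventually_atTop.2 ⟨N + 2, fun n hn => ?_⟩
    obtain ⟨m, rfl⟩ : ∃ m, n = m + 2 := ⟨n - 2, by omega⟩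
    have h1 := hN m (by omega)
    have h2 := mul_rotHpCoeff_one_le hy.le m
    have hy0 : y ≠ 0 := hy.ne'
    calc r ^ (m + 2) = y * (r ^ 2 / y * r ^ m) := by rw [pow_add]; field_simp
      _ ≤ y * rotHpCoeff m 1 := mul_le_mul_of_nonneg_left h1 hy.le
      _ ≤ rotHpCoeff (m + 2) y := h2

/-- The two halves of R4 at once, the lower one sharpened to EVENTUAL: `0 < y ≤ y†` ⇒ `RotGrowthLe y ∧ RotGrowthGeRate y μ`.
[cite: Beaton2014RotatedHoneycomb, Proposition 7 (arXiv v3 p. 11: "μ(y) = μ if y ≤ y_c")] -/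
theorem rotGrowth_rates_of_le {y : ℝ} (hy0 : 0 < y) (hy : y ≤ rotYdagger) : RotGrowthLe y ∧ RotGrowthGeRate y hexConnectiveConstant :=
  ⟨(rotGrowthLe_iff_le hy0).2 hy, rotGrowthGeRate_mu_of_pos hy0⟩

/-! ### The limit `μ(y) = μ` on `0 < y ≤ y†` -/

/-- **Squeeze**: `limsup ≤ μ` (R4's `RotGrowthLe`) and `liminf ≥ μ` (rate form) give `C⁺_n(y)^{1/n} → μ`.
[cite: Beaton2014RotatedHoneycomb, Proposition 7 (arXiv v3 p. 11: "μ(y) = μ if y ≤ y_c")] -/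
theorem tendsto_rotHpCoeff_rpow_of_rates {y : ℝ} (hy : 0 ≤ y) (hle : RotGrowthLe y) (hge : RotGrowthGeRate y hexConnectiveConstant) :
    Tendsto (fun n : ℕ => rotHpCoeff n y ^ ((n : ℝ)⁻¹)) atTop (𝓝 hexConnectiveConstant) := by
  have hμ := hexConnectiveConstant_pos
  rw [tendsto_order]
  constructor
  · intro a ha
    set r := (max a 0 + hexConnectiveConstant) / 2 with hr_def
    have hmax : max a 0 < hexConnectiveConstant := max_lt ha hμ
    have hr0 : 0 ≤ r := by rw [hr_def]; have := le_max_right a 0; linarith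
    have har : a < r := by rw [hr_def]; have := le_max_left a 0; linarith
    have hrμ : r < hexConnectiveConstant := by rw [hr_def]; linarith
    filter_upwards [hge r hr0 hrμ, eventually_ne_atTop 0] with n hn hn0
    calc a < r := har
      _ = (r ^ n) ^ ((n : ℝ)⁻¹) := (Real.pow_rpow_inv_natCast hr0 hn0).symm
      _ ≤ rotHpCoeff n y ^ ((n : ℝ)⁻¹) := Real.rpow_le_rpow (pow_nonneg hr0 n) hn (inv_nonneg.2 (Nat.cast_nonneg n))
  · intro b hb
    set r := (b + hexConnectiveConstant) / 2 with hr_def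
    have hμr : hexConnectiveConstant < r := by rw [hr_def]; linarith
    have hrb : r < b := by rw [hr_def]; linarith
    have hr0 : 0 ≤ r := hμ.le.trans hμr.le
    filter_upwards [hle r hμr, eventually_ne_atTop 0] with n hn hn0
    calc rotHpCoeff n y ^ ((n : ℝ)⁻¹) ≤ (r ^ n) ^ ((n : ℝ)⁻¹) :=
          Real.rpow_le_rpow (rotHpCoeff_nonneg n hy) hn (inv_nonneg.2 (Nat.cast_nonneg n))
      _ = r := Real.pow_rpow_inv_natCast hr0 hn0
      _ < b := hrb

/-- **Beaton 2014 Proposition 7, "`μ(y) = μ` if `y ≤ y_c`", with `μ(y)` A LIMIT**: for `0 < y ≤ y†`, `C⁺_n(y)^{1/n} → μ = √(2+√2)` — the limit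
`μ(y) := lim_n C⁺_n(y)^{1/n}` EXISTS on the whole desorbed regime of the rotated frame (endpoint included) and equals `μ`; no appeal to
Hammersley–Torrie–Whittington. [cite: Beaton2014RotatedHoneycomb, Proposition 7 (arXiv v3 p. 11: "μ(y) := lim C_n^+(y)^{1/n} exists" and "μ(y) = μ if y ≤ y_c")] -/
theorem tendsto_rotHpCoeff_rpow_of_le {y : ℝ} (hy0 : 0 < y) (hy : y ≤ rotYdagger) :
    Tendsto (fun n : ℕ => rotHpCoeff n y ^ ((n : ℝ)⁻¹)) atTop (𝓝 hexConnectiveConstant) :=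
  tendsto_rotHpCoeff_rpow_of_rates hy0.le ((rotGrowthLe_iff_le hy0).2 hy) (rotGrowthGeRate_mu_of_pos hy0)

/-- Beaton's "For `0 < y ≤ 1`, `μ(y) = μ(1) = μ`" at `y = 1`, as a limit: `c⁺_n^{1/n} = C⁺_n(1)^{1/n} → μ`.
[cite: Beaton2014RotatedHoneycomb, Proposition 7 (arXiv v3 p. 11: "For 0 < y ≤ 1, μ(y) = μ(1) = μ")] -/
theorem tendsto_rotHpCoeff_one_rpow : Tendsto (fun n : ℕ => rotHpCoeff n 1 ^ ((n : ℝ)⁻¹)) atTop (𝓝 hexConnectiveConstant) :=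
  tendsto_rotHpCoeff_rpow_of_le one_pos one_lt_rotYdagger.le

/-- **The dichotomy in limit form**: for `y > 0`, `C⁺_n(y)^{1/n} → μ` iff `y ≤ y†` (above `y†` a rate `r > μ` recurs, R4's `rotGrowthGt_iff`).
[cite: Beaton2014RotatedHoneycomb, Theorem 1 (arXiv v3 p. 2) with Proposition 7 (p. 11: "μ(y) = μ if y ≤ y_c, > μ if y > y_c")] -/
theorem tendsto_rotHpCoeff_rpow_iff {y : ℝ} (hy0 : 0 < y) :
    Tendsto (fun n : ℕ => rotHpCoeff n y ^ ((n : ℝ)⁻¹)) atTop (𝓝 hexConnectiveConstant) ↔ y ≤ rotYdagger := by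
  refine ⟨fun h => ?_, tendsto_rotHpCoeff_rpow_of_le hy0⟩
  by_contra hlt
  rw [not_le] at hlt
  obtain ⟨r, hμr, hfr⟩ := (rotGrowthGt_iff hy0).2 hlt
  have hμ := hexConnectiveConstant_pos
  set s := (hexConnectiveConstant + r) / 2 with hs
  have hμs : hexConnectiveConstant < s := by rw [hs]; linarith
  have hsr : s < r := by rw [hs]; linarith
  have hev := (tendsto_order.1 h).2 s hμs
  obtain ⟨n, hn, hns, hn0⟩ := (hfr.and_eventually (hev.and (eventually_ne_atTop 0))).exists
  have hr0 : 0 ≤ r := hμ.le.trans hμr.le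
  have : r ≤ rotHpCoeff n y ^ ((n : ℝ)⁻¹) :=
    calc r = (r ^ n) ^ ((n : ℝ)⁻¹) := (Real.pow_rpow_inv_natCast hr0 hn0).symm
      _ ≤ rotHpCoeff n y ^ ((n : ℝ)⁻¹) := Real.rpow_le_rpow (pow_nonneg hr0 n) hn (inv_nonneg.2 (Nat.cast_nonneg n))
  linarith

/-- The dichotomy against R3's sup-radius `hexRotSurfaceYc` (`hexRotSurfaceYc_eq`). [cite: Beaton2014RotatedHoneycomb, Theorem 1 (arXiv v3 p. 2) with Proposition 7 (p. 11)] -/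
theorem tendsto_rotHpCoeff_rpow_iff_le_hexRotSurfaceYc {y : ℝ} (hy0 : 0 < y) :
    Tendsto (fun n : ℕ => rotHpCoeff n y ^ ((n : ℝ)⁻¹)) atTop (𝓝 hexConnectiveConstant) ↔ y ≤ hexRotSurfaceYc := by
  rw [hexRotSurfaceYc_eq]; exact tendsto_rotHpCoeff_rpow_iff hy0

end HV

end Literature.Probability.RandomPlanarGeometry.SAW
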